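import Mathlib
import Literature.Analysis.FluidPDE.SelfSimilar
import Literature.Analysis.FluidPDE.SteadyLiouvilleCriteria
import Literature.Analysis.FluidPDE.SteadyLiouvilleTsaiEnergy
import Summits.NavierStokesRegularity.NavierStokesRegularity.Theses.PlaneEnergyCeiling
import Summits.NavierStokesRegularity.NavierStokesRegularity.Theorems.PlaneEnergyCeilingScaledEnergyOfPlanar

/-!
# Route PlaneEnergyCeiling · support `SteadyPlanarLiouville` (stmt-NavierStokesRegularity-16861)
# — the steady corner of the Liouville crux

A smooth bounded divergence-free steady solution `w` of `(w·∇)w + ∇q = Δw` on `ℝ³` whose planar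
kinetic energies `∫_{R({x₂=c})} |w|² dA` are bounded (`≤ M` on every plane) is identically zero.

Proof. By the support item `ScaledEnergyOfPlanar` (`planeEnergyCeiling_scaledEnergyOfPlanar`, landed) the
planar ceiling gives `∫_{B_r(0)} |w|² ≤ 2rM` for every `r > 0` (`w ∈ Ṁ^{2,3}`). With `|w| ≤ K`,
`|w|^{12/5} ≤ K^{2/5}|w|²`, so Tsai's annular quantity at `δ = 1`, `L = 2`,
`R⁻¹ ‖w‖²_{L^{12/5}(R<|x|<2R)} = R⁻¹ (∫_{R<|x|<2R} |w|^{12/5})^{5/6} ≤ R⁻¹ (4MK^{2/5} R)^{5/6}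
= C R^{-1/6} → 0`; hence its `liminf` at `R → ∞` vanishes and Tsai 2021, Thm 1.1 (a) (in tree and
PROVED: `Tsai2021_annular_liouville_holds`, for the `C²` steady class `IsLerayProfile 1 0 w q`)
gives `w = 0`.

References: T.-P. Tsai, *Liouville type theorems for stationary Navier–Stokes equations*, SN PDE
2 (2021), Thm 1.1 (a) with `δ = 1`, `q = 12/5` [Tsai2021]; Chamorro–Jarrín–Lemarié-Rieusset
arXiv:1806.03003 (bounded `∩ Ṁ^{2,3}` steady solutions vanish); Seregin 2016.
-/

noncomputable section

-- single-conjunct summit: `Summit.<Summit>.<Problem>` repeats the name by the D-0017 layout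
set_option linter.dupNamespace false

namespace Summit.NavierStokesRegularity.NavierStokesRegularity.Theorems.SteadyPlanarLiouville

open MeasureTheory Set Metric Filter Topology WithLp
open scoped ENNReal
open Literature.Analysis.FluidPDE

/-- **Tsai's annular quantity decays under a scaled-energy ceiling and a sup bound.** If
`‖w‖ ≤ K` pointwise and `∫_{B_r(0)} |w|² ≤ 2rM` for all `r > 0`, then for `R > 0`
`tsaiAnnulusQuantity 1 2 w R ≤ ofReal (R⁻¹ · (K^{2/5} · 4RM)^{5/6})` (`|w|^{12/5} ≤ K^{2/5}|w|²`
on the annulus `R < |x| < 2R ⊆ B_{2R}`). -/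
theorem tsaiAnnulusQuantity_one_two_le {w : EuclideanSpace ℝ (Fin 3) → EuclideanSpace ℝ (Fin 3)}
    {K M : ℝ} (hK0 : 0 ≤ K) (hM0 : 0 ≤ M) (hK : ∀ x, ‖w x‖ ≤ K)
    (hsc : ∀ r : ℝ, 0 < r → ∫⁻ x in ball (0 : EuclideanSpace ℝ (Fin 3)) r, ‖w x‖ₑ ^ 2 ≤
      ENNReal.ofReal (2 * r * M)) {R : ℝ} (hR : 0 < R) :
    tsaiAnnulusQuantity 1 2 w R ≤
      ENNReal.ofReal (R⁻¹ * (K ^ (2 / 5 : ℝ) * (2 * (2 * R) * M)) ^ (5 / 6 : ℝ)) := by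
  have hq : (6 * (3 - 1) / (6 - 1) : ℝ) = 2 / 5 + 2 := by norm_num
  have hp : ((6 - 1) / 6 : ℝ) = 5 / 6 := by norm_num
  -- pointwise: `‖w x‖ₑ^{12/5} ≤ (ofReal K)^{2/5} ‖w x‖ₑ²`
  have hpt : ∀ x, ‖w x‖ₑ ^ (6 * (3 - 1) / (6 - 1) : ℝ) ≤
      ENNReal.ofReal K ^ (2 / 5 : ℝ) * ‖w x‖ₑ ^ 2 := fun x => by
    rw [hq, ENNReal.rpow_add_of_nonneg _ _ (by norm_num) (by norm_num), ENNReal.rpow_two]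
    gcongr
    rw [← ofReal_norm]
    exact ENNReal.ofReal_le_ofReal (hK x)
  -- the annulus sits in the ball `B_{2R}`
  have hsub : {x : EuclideanSpace ℝ (Fin 3) | R < ‖x‖ ∧ ‖x‖ < 2 * R} ⊆
      ball (0 : EuclideanSpace ℝ (Fin 3)) (2 * R) := fun x hx => mem_ball_zero_iff.2 hx.2
  have hA : ∫⁻ x in {x : EuclideanSpace ℝ (Fin 3) | R < ‖x‖ ∧ ‖x‖ < 2 * R},
      ‖w x‖ₑ ^ (6 * (3 - 1) / (6 - 1) : ℝ) ≤
        ENNReal.ofReal (K ^ (2 / 5 : ℝ) * (2 * (2 * R) * M)) := by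
    calc ∫⁻ x in {x : EuclideanSpace ℝ (Fin 3) | R < ‖x‖ ∧ ‖x‖ < 2 * R},
          ‖w x‖ₑ ^ (6 * (3 - 1) / (6 - 1) : ℝ)
        ≤ ∫⁻ x in {x : EuclideanSpace ℝ (Fin 3) | R < ‖x‖ ∧ ‖x‖ < 2 * R},
            ENNReal.ofReal K ^ (2 / 5 : ℝ) * ‖w x‖ₑ ^ 2 := lintegral_mono fun x => hpt x
      _ ≤ ∫⁻ x in ball (0 : EuclideanSpace ℝ (Fin 3)) (2 * R),
            ENNReal.ofReal K ^ (2 / 5 : ℝ) * ‖w x‖ₑ ^ 2 := lintegral_mono_set hsub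
      _ = ENNReal.ofReal K ^ (2 / 5 : ℝ) *
            ∫⁻ x in ball (0 : EuclideanSpace ℝ (Fin 3)) (2 * R), ‖w x‖ₑ ^ 2 :=
          lintegral_const_mul' _ _ (ENNReal.rpow_ne_top_of_nonneg (by norm_num) ENNReal.ofReal_ne_top)
      _ ≤ ENNReal.ofReal K ^ (2 / 5 : ℝ) * ENNReal.ofReal (2 * (2 * R) * M) := by
          gcongr
          exact hsc (2 * R) (by positivity)
      _ = ENNReal.ofReal (K ^ (2 / 5 : ℝ) * (2 * (2 * R) * M)) := by
          rw [ENNReal.ofReal_rpow_of_nonneg hK0 (by norm_num), ← ENNReal.ofReal_mul (by positivity)]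
  -- assemble
  unfold tsaiAnnulusQuantity
  rw [hp, ENNReal.ofReal_mul (inv_nonneg.2 hR.le), ← ENNReal.ofReal_inv_of_pos hR,
    ← ENNReal.ofReal_rpow_of_nonneg (by positivity) (by norm_num)]
  gcongr

/-- The majorant `R⁻¹ (c R)^{5/6} = c^{5/6} R^{-1/6}` tends to `0` as `R → ∞` (`c ≥ 0`). -/
theorem tendsto_inv_mul_rpow_five_sixths {c : ℝ} (hc : 0 ≤ c) :
    Tendsto (fun R : ℝ => R⁻¹ * (c * R) ^ (5 / 6 : ℝ)) atTop (𝓝 0) := by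
  have h1 : Tendsto (fun R : ℝ => c ^ (5 / 6 : ℝ) * R ^ (-(1 / 6) : ℝ)) atTop (𝓝 0) := by
    simpa using (tendsto_rpow_neg_atTop (by norm_num : (0 : ℝ) < 1 / 6)).const_mul (c ^ (5 / 6 : ℝ))
  refine h1.congr' ?_
  filter_upwards [eventually_gt_atTop 0] with R hR
  rw [Real.mul_rpow hc hR.le, Real.rpow_neg hR.le, ← Real.rpow_neg_one R,
    show (-1 : ℝ) = -(1 / 6) - 5 / 6 by norm_num, Real.rpow_sub hR, Real.rpow_neg hR.le]
  field_simp

/-- **Support item `SteadyPlanarLiouville` (stmt-NavierStokesRegularity-16861), proved**: a smooth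
bounded divergence-free steady solution `w` of `(w·∇)w + ∇q = Δw` on `ℝ³` with bounded planar
energies vanishes identically — `ScaledEnergyOfPlanar` puts `w` in `Ṁ^{2,3}`, boundedness makes
Tsai's `δ = 1` annular quantity `O(R^{-1/6})`, and Tsai 2021 Thm 1.1 (a)
(`Tsai2021_annular_liouville_holds`) concludes. -/
theorem steadyPlanarLiouville_proof :
    Summit.NavierStokesRegularity.NavierStokesRegularity.Theses.PlaneEnergyCeiling.SteadyPlanarLiouville := by
  intro w q hw hq hdiv heq hbdd hpl x
  obtain ⟨K, hK⟩ := hbdd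
  obtain ⟨M, hM⟩ := hpl
  have hK0 : 0 ≤ K := (norm_nonneg _).trans (hK 0)
  -- a nonnegative planar bound
  set M' : ℝ := max M 0 with hM'
  have hM'0 : 0 ≤ M' := le_max_right _ _
  have hM'b : ∀ (R : EuclideanSpace ℝ (Fin 3) ≃ₗᵢ[ℝ] EuclideanSpace ℝ (Fin 3)) (c : ℝ),
      ∫⁻ y : EuclideanSpace ℝ (Fin 2), ‖w (R (toLp 2 ![y 0, y 1, c]))‖ₑ ^ 2 ≤ ENNReal.ofReal M' :=
    fun R c => (hM R c).trans (ENNReal.ofReal_le_ofReal (le_max_left _ _))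
  -- the steady profile system (`ν = 1`, `a = 0`)
  have hprof : IsLerayProfile 1 0 w q :=
    { contDiff_velocity := hw.of_le (by norm_cast)
      contDiff_pressure := hq.of_le (by norm_cast)
      profile_eq := fun y => by
        rw [one_smul, zero_smul, zero_smul, add_zero, add_zero, ← heq y]
        abel
      divFree := hdiv }
  -- scaled energies from the planar ceiling
  have hsc : ∀ r : ℝ, 0 < r → ∫⁻ z in ball (0 : EuclideanSpace ℝ (Fin 3)) r, ‖w z‖ₑ ^ 2 ≤
      ENNReal.ofReal (2 * r * M') := fun r hr =>
    Summit.NavierStokesRegularity.NavierStokesRegularity.Theorems.PlanarEnergyAPriori.planeEnergyCeiling_scaledEnergyOfPlanar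
      w hw.continuous M' hM'0 hM'b 0 r hr
  -- Tsai's quantity tends to zero
  have hG : Tendsto (fun R : ℝ => ENNReal.ofReal (R⁻¹ * (K ^ (2 / 5 : ℝ) * (4 * M') * R) ^ (5 / 6 : ℝ)))
      atTop (𝓝 0) := by
    rw [← ENNReal.ofReal_zero]
    exact ENNReal.tendsto_ofReal (tendsto_inv_mul_rpow_five_sixths (by positivity))
  have hle : ∀ᶠ R in atTop, tsaiAnnulusQuantity 1 2 w R ≤
      ENNReal.ofReal (R⁻¹ * (K ^ (2 / 5 : ℝ) * (4 * M') * R) ^ (5 / 6 : ℝ)) := by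
    filter_upwards [eventually_gt_atTop 0] with R hR
    have h := tsaiAnnulusQuantity_one_two_le hK0 hM'0 hK hsc hR
    rwa [show K ^ (2 / 5 : ℝ) * (2 * (2 * R) * M') = K ^ (2 / 5 : ℝ) * (4 * M') * R by ring] at h
  have hT : Tendsto (tsaiAnnulusQuantity 1 2 w) atTop (𝓝 0) :=
    tendsto_of_tendsto_of_tendsto_of_le_of_le' tendsto_const_nhds hG
      (Eventually.of_forall fun _ => zero_le) hle
  have h0 : w = 0 :=
    Tsai2021_annular_liouville_holds 1 one_pos w q hprof 1 2 zero_le_one le_rfl one_lt_two hT.liminf_eq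
  rw [h0]
  rfl

end Summit.NavierStokesRegularity.NavierStokesRegularity.Theorems.SteadyPlanarLiouville

end
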